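import Mathlib.Topology.Semicontinuity.Defs
import Literature.AlgebraicGeometry.Hironaka2017.S04CharAlgebra.R007cEq34
import Literature.AlgebraicGeometry.Hironaka2017.S04CharAlgebra.R005bEdgeData
import HarnessLib

/-!
# [OURS · L1 W3.1] Upper semicontinuity of `ξ ↦ Inv_ξ(E)` for ONE ideal exponent — campaign STATEMENT
# (`CampaignW31UscInvOneExponent`), rung L (rescue) of LADDER-RESOLUTION, slot W3.1 «u.s.c. first» (positive rung)

Cell `res-hironaka` (run/shared/lean/pub/res-hironaka/): plan/RESCUE-SEED.md §1 row W3.1, L/SLOTS.md §W3.1,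
ledger/group-3/DOSSIER.md §1 R13 / §2 R13a–R13b (adjudication group 3). Typed by the OURS typer o4 (statement-only
lane) for the slot planner res-L1-s31-plan-1. HOST (custody, no new route): the EXISTING crux
`Theses.MarkedTransfer.HypersurfaceOrderReduction` (stmt-ResolutionOfSingularities-16155) — the crux in whose setting
(hypersurface marked ideals over a perfect field) a secondary invariant refining the order is consumed and which the
kill test K3.1 of this slot already supports (res-L1-k31 PREREG 2026-08-26T18:08:48Z); filed `--kind definition
--supports stmt-ResolutionOfSingularities-16155`; the slot planner may re-home the rank-9 item.

HONEST FRAMING. Every declaration below is OURS (a campaign statement about OUR typed objects) or pure logic;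
NOTHING here is a statement of H. Hironaka's manuscript *Resolution of singularities in positive characteristics*
(2017-03-23, [Hironaka2017], lit key `paper:url-3343fd9e678b`) and nothing here asserts that any statement of that
manuscript holds. The manuscript USES the sentence «We know that Inv_η(𝒴′(m−1)) is upper semi-continuous in
Sing(𝒴′(m−1))_cl because the same is true for every ideal exponent belonging to 𝒴′(m−1)» (p.86 l.7–10, proof of
Lem. 16.10; TYPED, not asserted, as `Literature.AlgebraicGeometry.Hironaka2017.S16Proof.U86_2` / `U86_5`) and, at
p.30 l.4–8, that «the lexicographical maximum of Inv_ξ(Ê) for all ξ ∈ Sing(Ê)_cl» exists and cuts out the closed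
stratum of Eq. (43); no statement or proof of the semicontinuity of `ξ ↦ Inv_ξ(E)` for a single ideal exponent `E`
is printed (GAP-LEDGER row R13). This file only STATES, over OUR typed carriers, what such a semicontinuity would
say; proving it (slot W3.1, seats res-L1-s31-pv-1…3) is a POSITIVE RUNG, bankable whatever M rules on R13.

## What is typed (all `Prop`-valued definitions; no theorem is proved here)

* `CampaignW31.UscOn S f` — for a point set `S ⊆ Z` and an `EdgeInv n`-valued function `f` (value type of row 007,
  `Literature.AlgebraicGeometry.Hironaka2017.Datum.EdgeInv n`, compared lexicographically through its 0-padded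
  `key`): `ξ ↦ f ξ` is upper semicontinuous on the CLOSED points of `S` (Mathlib `UpperSemicontinuousOn` through
  `EdgeInv.key`, subspace topology) — literally the shape of the typed p.86 sentence `S16Proof.U86_2 S f`.
* `CampaignW31.SuperlevelClosedOn S f` — the Cossart–Jannsen–Saito form of the same property (LNM 2270 Lemma 2.34,
  tree `Literature/Topology/NoetherianSpaces/UpperSemicontinuous.lean`): every superlevel set
  `{ξ ∈ S_cl | v ≤ f ξ}` is cut out of `S_cl` by a closed subset of `Z`. For the LINEAR order on `EdgeInv n` the two
  forms are equivalent (Mathlib `upperSemicontinuous_iff_isClosed_preimage` pattern, applied on the subspace `S_cl`); both are typed so that provers and the kill test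
  K3.1 can use either by name.
* `CampaignW31.EdgeDataSelection p n E IsEdgeData` — a CHOICE of edge data of `℘(E)` (row 005's carrier
  `S04CharAlgebra.EdgeDatumAt p n E ξ`, satisfying the Def. 4.9 provenance predicate `IsEdgeData`, taken as a
  parameter exactly as in row 007's `S04CharAlgebra.Thm4_19` until row 005 part b lands it) at EVERY closed point of
  `Sing(E)`; `CampaignW31.selInv sel : Z → EdgeInv n` is `ξ ↦ Inv_ξ(E)` read off that choice (row 007's `inv`,
  Eq. (34) p.24), with the harmless junk value `(n, n)` (empty exponent list) off `Sing(E)_cl`, never looked at by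
  `UpperSemicontinuousOn … (Sing(E) ∩ Z_cl)`.
* `CampaignW31.InvWellDefinedAt` / `CampaignW31InvWellDefined` — OURS: at a closed point of `Sing(E)` any two edge
  data with the Def. 4.9 provenance give the same value `Inv_ξ(E)` (what makes «`ξ ↦ Inv_ξ(E)`» a function at all;
  in print this is implicit in Def. 4.9 / Eq. (34)).
* `CampaignW31UscInvOneExponent IsEdgeData` — THE SLOT STATEMENT: for every prime `p`, perfect field `K` of
  characteristic `p`, ambient datum `A` (row 001: `Z` smooth irreducible of finite type over `K`), every `n` and every
  STANDARD ideal exponent `E = (J, b)` on `Z` (`J ≠ (0)`, `b > 0`), and every edge-data selection `sel` on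
  `Sing(E)_cl`, the function `ξ ↦ Inv_ξ(E)` is upper semicontinuous on `Sing(E)_cl`.
* `CampaignW31.IsHypersurfaceExponent`, `CampaignW31UscInvHypersurface` (+ the one-line anchor
  `campaignW31UscInvHypersurface_of_oneExponent`) — the HYPERSURFACE rung (`J` effective Cartier, tree
  `Resolution.IsEffectiveCartier`, the setting of the host crux `Theses.MarkedTransfer.HypersurfaceOrderReduction`
  stmt-16155 and of kill test K3.1's specimen `(y² − x²z² + x⁵, 2)`), seat res-L1-s31-pv-1.
* `CampaignW31.IsInvReading`, `CampaignW31.EdgeDataExist`, `CampaignW31UscInvOneExponentR` — the same slot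
  statement in the PARAMETRIC `inv`-slot idiom of rows 010/019/020 (`inv : IdealExponent W → W → EdgeInv n`
  consistent with row 007's `inv` on provenance edge data; edge data exist on `Sing(E)_cl`), so that consumers typed
  over that slot can cite it by name.
* `CampaignW31.InvmaxAttained`, `CampaignW31.InvmaxStratumClosed` — the two consequences the manuscript needs at
  p.30 l.4–8 (DOSSIER §2 R13b): the lexicographic maximum is attained on `Sing(E)_cl` (row 007's `IsInvmax`) and the
  `Inv_max`-stratum (row 007's `invmaxStratum`) is cut out of `Sing(E)_cl` by a closed set.

## Vacuity self-check (T-lint; for the lanes)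

* Not trivially true: for `n = dim Z` edge-data selections exist whenever edge data exist at each closed singular
  point (the manuscript's Rem. 4.10 «we … can choose», row 005 part b `Rem4_10_exists`), and u.s.c. of a function
  into a linear order with ≥ 2 values is a genuine topological condition. Not trivially false: no hypothesis is
  contradictory (`E` standard on a smooth `Z` is the §2 standing datum). Caveat (design, as in `Thm4_19`): the
  statement is PARAMETRIC in the provenance predicate `IsEdgeData`; instantiating it with a predicate no datum
  satisfies makes every selection type empty and the statement vacuous — the intended instance is row 005 part b's
  `S04CharAlgebra.IsEdgeData` (Def. 4.9: lifts of a minimum system of homogeneous generators of `ν(℘(E)_ξ)`).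
* For `n ≠ dim Z` the carrier `EdgeDatumAt p n E ξ` is empty at closed points (its field `spanFinrank_eq` pins `n`
  to the embedding dimension of `O_{Z,ξ}`), so the statement is vacuous there BY DESIGN; the content sits at
  `n = dim Z`, as in Eq. (34) «with n = dim Z».

## References (context; nothing below is used as a premise)

* H. Hironaka, ms. 2017-03-23, Eq. (34) p.24 l.29–31; §6.2 p.30 l.4–8; proof of Lem. 16.10 p.86 l.7–10 — quoted
  for scope only, under adjudication. [Hironaka2017]
* V. Cossart, U. Jannsen, S. Saito, *Desingularization: Invariants and Strategy*, LNM 2270 (2020), Lemma 2.34 /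
  Thm. 2.33 (u.s.c. of the Hilbert–Samuel function — a DIFFERENT invariant; comparison pattern only).
  [CossartJannsenSaito2020]
* H. Kawanoue, K. Matsuki, Publ. RIMS 46 (2010), Prop. 1.2.2.1 (u.s.c. of their invariant σ — FACT-LIST §C context,
  never a premise about `Inv`). [KawanoueMatsuki2010]
-/

noncomputable section

set_option linter.dupNamespace false -- mandated namespace of this single-conjunct summit

open _root_.AlgebraicGeometry _root_.TopologicalSpace

namespace Summit.ResolutionOfSingularities.ResolutionOfSingularities.Theorems

open Literature.AlgebraicGeometry.Resolution
open Literature.AlgebraicGeometry.Hironaka2017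
open Literature.AlgebraicGeometry.Hironaka2017.S02Preliminaries
open Literature.AlgebraicGeometry.Hironaka2017.S04CharAlgebra
open Literature.AlgebraicGeometry.Hironaka2017.Datum

universe u

namespace CampaignW31

variable {Z : Scheme.{u}} {n : ℕ}

/-- [OURS · L1 W3.1] replaces the role of the sentence p.86 l.7–10 («We know that Inv_η(𝒴′(m−1)) is upper
semi-continuous in Sing(𝒴′(m−1))_cl …») for ONE `EdgeInv n`-valued function; NOT a statement of the manuscript. Generic form: for a point set
`S ⊆ Z` and `f : Z → EdgeInv n`, the function `ξ ↦ f ξ` is upper semicontinuous on the closed points of `S`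
(subspace topology; Mathlib `UpperSemicontinuousOn` through the 0-padded lexicographic `EdgeInv.key`, which DEFINES
the order of the value type). Same shape as the typed candidate `S16Proof.U86_2 S f`. [folklore] -/
def UscOn (S : Set Z) (f : Z → EdgeInv n) : Prop :=
  UpperSemicontinuousOn (fun ξ => (f ξ).key) (S ∩ S02Preliminaries.closedPoints Z)

/-- [OURS · L1 W3.1] replaces the role of the same p.86 l.7–10 sentence, in the superlevel-set form of upper
semicontinuity on `S_cl` (Cossart–Jannsen–Saito LNM 2270
Lemma 2.34 pattern, tree `Literature/Topology/NoetherianSpaces/UpperSemicontinuous.lean`): for every value `v`,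
the set `{ξ ∈ S_cl | v ≤ f ξ}` is the trace on `S_cl` of a closed subset of `Z`. Equivalent to `UscOn S f` because
`EdgeInv n` is linearly ordered by `key`; typed separately so that either form can be cited by name. NOT a statement
of the manuscript. [folklore] -/
def SuperlevelClosedOn (S : Set Z) (f : Z → EdgeInv n) : Prop :=
  ∀ v : EdgeInv n, ∃ C : Set Z, IsClosed C ∧ ∀ ξ ∈ S ∩ S02Preliminaries.closedPoints Z, (v ≤ f ξ ↔ ξ ∈ C)

/-- [OURS · L1 W3.1] an EDGE-DATA SELECTION for `E` on `Sing(E)_cl`: at every closed point `ξ` of `Sing(E)` a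
choice `D ξ _ : EdgeDatumAt p n E ξ` of edge data of `℘(E)` at `ξ` (row 005's carrier: `r` edge generators
`g_j = y_j^{q_j} + ε_j ∈ ℘(E, q_j)_ξ`, `q_j = p^{e_j}`, Eq. (24)–(28) p.20–21) satisfying the Def. 4.9 provenance
predicate `IsEdgeData` (lifts of a MINIMUM system of homogeneous generators of `ν(℘(E)_ξ)`; a parameter here, as in
row 007's `Thm4_19`, to be instantiated by row 005 part b's `S04CharAlgebra.IsEdgeData`). Replaces the role of the
implicit choice in Eq. (34) p.24 («the numerical invariants of ℘(E) at ξ»); NOT a statement of the manuscript.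
[folklore] -/
structure EdgeDataSelection (p n : ℕ) (E : IdealExponent Z)
    (IsEdgeData : ∀ ⦃X : Scheme.{u}⦄ ⦃p n : ℕ⦄ (E : IdealExponent X) (ξ : X), EdgeDatumAt p n E ξ → Prop) :
    Type u where
  /-- the chosen edge data of `℘(E)` at each closed point of `Sing(E)` -/
  D : ∀ ξ : Z, ξ ∈ E.sing ∩ S02Preliminaries.closedPoints Z → EdgeDatumAt p n E ξ
  /-- each choice has the Def. 4.9 provenance -/
  isEdgeData : ∀ (ξ : Z) (h : ξ ∈ E.sing ∩ S02Preliminaries.closedPoints Z), IsEdgeData E ξ (D ξ h)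

/-- [OURS · L1 W3.1] rendering device (replaces the role of reading Eq. (34) p.24 as a function of the point):
`ξ ↦ Inv_ξ(E)` READ OFF an edge-data selection: at a closed point of `Sing(E)` the value
`inv (sel.D ξ _) = (n, n − r, q_1, …, q_r)` of row 007 (Eq. (34) p.24); off `Sing(E)_cl` the junk value with empty
exponent list (never inspected by `UscOn`/`SuperlevelClosedOn`, which only look at `Sing(E)_cl`). NOT a statement of
the manuscript. [folklore] -/
def selInv {p : ℕ} [Fact p.Prime] {E : IdealExponent Z}
    {IsEdgeData : ∀ ⦃X : Scheme.{u}⦄ ⦃p n : ℕ⦄ (E : IdealExponent X) (ξ : X), EdgeDatumAt p n E ξ → Prop}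
    (sel : EdgeDataSelection p n E IsEdgeData) (ξ : Z) : EdgeInv n :=
  open scoped Classical in
  if h : ξ ∈ E.sing ∩ S02Preliminaries.closedPoints Z then inv (sel.D ξ h)
  else ⟨[], Nat.zero_le n, fun _ h => nomatch h⟩

/-- [OURS · L1 W3.1] well-definedness of `Inv_ξ(E)` AT a point: any two edge data of `℘(E)` at `ξ` with the
Def. 4.9 provenance have the same value `(n, n − r, q_1, …, q_r)` (row 007's `inv`). Replaces the role of the
implicit claim of Def. 4.9 / Eq. (34) p.24 that the «numerical invariants of ℘(E) at ξ» do not depend on the chosen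
edge data; NOT a statement of the manuscript. [folklore] -/
def InvWellDefinedAt (p n : ℕ) [Fact p.Prime] (E : IdealExponent Z)
    (IsEdgeData : ∀ ⦃X : Scheme.{u}⦄ ⦃p n : ℕ⦄ (E : IdealExponent X) (ξ : X), EdgeDatumAt p n E ξ → Prop)
    (ξ : Z) : Prop :=
  ∀ D D' : EdgeDatumAt p n E ξ, IsEdgeData E ξ D → IsEdgeData E ξ D' → inv D = inv D'

/-- [OURS · L1 W3.1] `Inv_max(E)` IS ATTAINED on `Sing(E)_cl` for the function read off a selection (row 007's
`IsInvmax`): what p.30 l.4–5 («Let Inv_max(Ê) denote the lexicographical maximum of Inv_ξ(Ê) for all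
ξ ∈ Sing(Ê)_cl») presupposes; DOSSIER §2 R13b consequence (i) of semicontinuity + finitely many values on a
Noetherian space. Replaces the role of that presupposition; NOT a statement of the manuscript. [folklore] -/
def InvmaxAttained {p : ℕ} [Fact p.Prime] {E : IdealExponent Z}
    {IsEdgeData : ∀ ⦃X : Scheme.{u}⦄ ⦃p n : ℕ⦄ (E : IdealExponent X) (ξ : X), EdgeDatumAt p n E ξ → Prop}
    (sel : EdgeDataSelection p n E IsEdgeData) : Prop :=
  (E.sing ∩ S02Preliminaries.closedPoints Z).Nonempty →
    ∃ v : EdgeInv n, IsInvmax (E.sing ∩ S02Preliminaries.closedPoints Z) (selInv sel) v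

/-- [OURS · L1 W3.1] the `Inv_max`-STRATUM IS CLOSED in `Sing(E)_cl` (row 007's `invmaxStratum`, the right-hand
side of Eq. (43) p.30 l.8): it is the trace on `Sing(E)_cl` of a closed subset of `Z` — DOSSIER §2 R13b consequence
(ii), what Eq. (43) needs in order to prescribe it as the closed singular locus of another ideal exponent. Replaces
the role of that presupposition; NOT a statement of the manuscript. [folklore] -/
def InvmaxStratumClosed {p : ℕ} [Fact p.Prime] {E : IdealExponent Z}
    {IsEdgeData : ∀ ⦃X : Scheme.{u}⦄ ⦃p n : ℕ⦄ (E : IdealExponent X) (ξ : X), EdgeDatumAt p n E ξ → Prop}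
    (sel : EdgeDataSelection p n E IsEdgeData) : Prop :=
  ∃ C : Set Z, IsClosed C ∧
    invmaxStratum (E.sing ∩ S02Preliminaries.closedPoints Z) (selInv sel) =
      C ∩ (E.sing ∩ S02Preliminaries.closedPoints Z)

/-- [OURS · L1 W3.1] an `Inv`-READING consistent with Eq. (34): a function `inv : (E, ξ) ↦ Inv_ξ(E)` in the
PARAMETRIC idiom of rows 010/019/020 (`S06BaseHike.Eq43`, `S06BaseHike.U30_2`, `S16Proof.U87_2` bind
`inv : IdealExponent W → W → EdgeInv n`) which, at every point carrying edge data with the Def. 4.9 provenance,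
returns row 007's value `S04CharAlgebra.inv D = (n, n − r, q_1, …, q_r)`. Replaces the role of the implicit
identification of «Inv_ξ(E)» (Eq. (34) p.24) with a function of `(E, ξ)`; NOT a statement of the manuscript.
[folklore] -/
def IsInvReading (p n : ℕ) [Fact p.Prime]
    (IsEdgeData : ∀ ⦃X : Scheme.{u}⦄ ⦃p n : ℕ⦄ (E : IdealExponent X) (ξ : X), EdgeDatumAt p n E ξ → Prop)
    (inv : ∀ ⦃W : Scheme.{u}⦄, IdealExponent W → W → EdgeInv n) : Prop :=
  ∀ ⦃W : Scheme.{u}⦄ (E : IdealExponent W) (ξ : W) (D : EdgeDatumAt p n E ξ),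
    IsEdgeData E ξ D → inv E ξ = S04CharAlgebra.inv D

/-- [OURS · L1 W3.1] edge data with the Def. 4.9 provenance EXIST at every closed point of `Sing(E)` (the
hypothesis under which an `Inv`-reading is pinned down on `Sing(E)_cl`; in print: Rem. 4.10 p.21 l.4–7 «we … can
choose», row 005 part b `Rem4_10_exists`). Replaces the role of that presupposition; NOT a statement of the
manuscript. [folklore] -/
def EdgeDataExist (p n : ℕ) (E : IdealExponent Z)
    (IsEdgeData : ∀ ⦃X : Scheme.{u}⦄ ⦃p n : ℕ⦄ (E : IdealExponent X) (ξ : X), EdgeDatumAt p n E ξ → Prop) :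
    Prop :=
  ∀ ξ ∈ E.sing ∩ S02Preliminaries.closedPoints Z, ∃ D : EdgeDatumAt p n E ξ, IsEdgeData E ξ D

/-- [OURS · L1 W3.1] regime predicate (replaces nothing printed; restricts the §2 datum `E = (J, b)` p.4 l.35 / p.6
l.37–38 to hypersurfaces) — HYPERSURFACE ideal exponent: `E = (J, b)` standard (`J ≠ (0)`, `b > 0`, row 001 `IsStandard`) with
`J` an EFFECTIVE CARTIER ideal sheaf (tree `Resolution.IsEffectiveCartier`: every point has an affine neighbourhood on
which `J` is generated by one non-zero-divisor — on the integral ambient `Z` the same as locally principal and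
non-zero), i.e. the hypothesis vocabulary of the EXISTING crux `Theses.MarkedTransfer.HypersurfaceOrderReduction`
(stmt-ResolutionOfSingularities-16155, marked ideals `(X, I, E, m)` with `I` effective Cartier). The regime of seat
res-L1-s31-pv-1 («u.s.c. for hypersurface exponents») and of the kill test K3.1 specimen `(y² − x²z² + x⁵, 2)`.
NOT a statement of the manuscript. [folklore] -/
def IsHypersurfaceExponent (E : IdealExponent Z) : Prop :=
  E.IsStandard ∧ IsEffectiveCartier E.J

end CampaignW31

open CampaignW31

/-- **[OURS · L1 W3.1] `CampaignW31InvWellDefined`** — replaces the role of the implicit well-definedness of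
Eq. (34) p.24 l.29–31 («We define the numerical invariants of ℘(E) at ξ as follows. Inv_ξ(E) = (n, n−r, q_1, …, q_r)
with n = dim Z»); NOT a statement of the manuscript. For every prime `p`, perfect field `K` of characteristic `p`,
ambient datum `A` (row 001: `A.Z` smooth irreducible of finite type over `K`), every `n`, every STANDARD ideal
exponent `E` on `A.Z` (row 001 `IsStandard`: `J ≠ (0)`, `b > 0`) and every closed point `ξ ∈ Sing(E)`: the value
`Inv_ξ(E)` does not depend on the edge data chosen (`CampaignW31.InvWellDefinedAt`). Parametric in the Def. 4.9
provenance predicate `IsEdgeData` (row 005 part b). [folklore] -/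
def CampaignW31InvWellDefined
    (IsEdgeData : ∀ ⦃X : Scheme.{u}⦄ ⦃p n : ℕ⦄ (E : IdealExponent X) (ξ : X), EdgeDatumAt p n E ξ → Prop) :
    Prop :=
  ∀ (p : ℕ) [Fact p.Prime] (K : Type u) [Field K] [CharP K p] [PerfectField K] (A : AmbientDatum p K) (n : ℕ)
    (E : IdealExponent A.Z), E.IsStandard →
      ∀ ξ ∈ E.sing ∩ S02Preliminaries.closedPoints A.Z, InvWellDefinedAt p n E IsEdgeData ξ

/-- **[OURS · L1 W3.1] `CampaignW31UscInvOneExponent` — THE SLOT STATEMENT** (RESCUE-SEED §1 W3.1 «U.S.C. FIRST»,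
positive rung): replaces the role of the semicontinuity the manuscript USES at p.30 l.4–8 (Eq. (43): the
`Inv_max`-stratum as a closed singular locus) and ASSERTS at p.86 l.7–10 (proof of Lem. 16.10, typed as
`S16Proof.U86_2`/`U86_5`), for ONE ideal exponent; NOT a statement of the manuscript (which prints no such
statement for a single `E`, GAP-LEDGER R13). For every prime `p`, perfect field `K` of characteristic `p`, ambient
datum `A` over `K` (row 001), every `n` (the content sits at `n = dim Z`, Eq. (34)), every STANDARD ideal exponent
`E = (J, b)` on `A.Z` and every edge-data selection `sel` on `Sing(E)_cl` with the Def. 4.9 provenance (parameter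
`IsEdgeData`, row 005 part b): `ξ ↦ Inv_ξ(E)` (row 007's `inv`, Eq. (34) p.24, lexicographic order with 0-padding as
in Th. 16.6 (2) p.84) is upper semicontinuous on the closed points of `Sing(E)` (`CampaignW31.UscOn`). Hypotheses =
OUR typed carriers only; no FACT-LIST premise is built in (a proof may CONSUME F-21f, the coherence / finite
generation of `℘(E)` imported from [23], as an explicit named hypothesis — then the gate records it conditional).
[folklore] -/
def CampaignW31UscInvOneExponent
    (IsEdgeData : ∀ ⦃X : Scheme.{u}⦄ ⦃p n : ℕ⦄ (E : IdealExponent X) (ξ : X), EdgeDatumAt p n E ξ → Prop) :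
    Prop :=
  ∀ (p : ℕ) [Fact p.Prime] (K : Type u) [Field K] [CharP K p] [PerfectField K] (A : AmbientDatum p K) (n : ℕ)
    (E : IdealExponent A.Z), E.IsStandard →
      ∀ sel : EdgeDataSelection p n E IsEdgeData, UscOn E.sing (selInv sel)

/-- **[OURS · L1 W3.1] `CampaignW31UscInvHypersurface` — the HYPERSURFACE RUNG of the slot statement** (seat
res-L1-s31-pv-1): the statement `CampaignW31UscInvOneExponent` restricted to hypersurface ideal exponents
(`CampaignW31.IsHypersurfaceExponent`: `J` effective Cartier, the setting of the host crux
`Theses.MarkedTransfer.HypersurfaceOrderReduction` stmt-16155 and of K3.1's specimen). Replaces the role of the same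
printed uses (p.30 l.4–8, p.86 l.7–10) in the hypersurface case; NOT a statement of the manuscript. [folklore] -/
def CampaignW31UscInvHypersurface
    (IsEdgeData : ∀ ⦃X : Scheme.{u}⦄ ⦃p n : ℕ⦄ (E : IdealExponent X) (ξ : X), EdgeDatumAt p n E ξ → Prop) :
    Prop :=
  ∀ (p : ℕ) [Fact p.Prime] (K : Type u) [Field K] [CharP K p] [PerfectField K] (A : AmbientDatum p K) (n : ℕ)
    (E : IdealExponent A.Z), IsHypersurfaceExponent E →
      ∀ sel : EdgeDataSelection p n E IsEdgeData, UscOn E.sing (selInv sel)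

/-- Pure logic: the general one-exponent statement implies its hypersurface rung. [folklore] -/
theorem campaignW31UscInvHypersurface_of_oneExponent
    {IsEdgeData : ∀ ⦃X : Scheme.{u}⦄ ⦃p n : ℕ⦄ (E : IdealExponent X) (ξ : X), EdgeDatumAt p n E ξ → Prop}
    (h : CampaignW31UscInvOneExponent IsEdgeData) : CampaignW31UscInvHypersurface IsEdgeData :=
  fun p _ K _ _ _ A n E hE sel => h p K A n E hE.1 sel

/-- **[OURS · L1 W3.1] `CampaignW31UscInvOneExponentCJS`** — the same slot statement in the superlevel-set form
(`CampaignW31.SuperlevelClosedOn`: every `{ξ ∈ Sing(E)_cl | v ≤ Inv_ξ(E)}` is the trace of a closed subset of `Z`),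
the form in which the tree's Noetherian-space lemmas (`isClosed_fiber_of_maximal`, `finite_range_of_…`,
`Literature/Topology/NoetherianSpaces/UpperSemicontinuous.lean`) consume semicontinuity. Replaces the role of the same
printed uses as `CampaignW31UscInvOneExponent`; NOT a statement of the manuscript. [folklore] -/
def CampaignW31UscInvOneExponentCJS
    (IsEdgeData : ∀ ⦃X : Scheme.{u}⦄ ⦃p n : ℕ⦄ (E : IdealExponent X) (ξ : X), EdgeDatumAt p n E ξ → Prop) :
    Prop :=
  ∀ (p : ℕ) [Fact p.Prime] (K : Type u) [Field K] [CharP K p] [PerfectField K] (A : AmbientDatum p K) (n : ℕ)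
    (E : IdealExponent A.Z), E.IsStandard →
      ∀ sel : EdgeDataSelection p n E IsEdgeData, SuperlevelClosedOn E.sing (selInv sel)

/-- **[OURS · L1 W3.1] `CampaignW31UscInvOneExponentR` — the slot statement in the READING idiom** of rows
010/019/020 (parametric `inv : IdealExponent W → W → EdgeInv n`): for every `Inv`-reading consistent with Eq. (34)
on provenance edge data (`CampaignW31.IsInvReading`), every prime `p`, perfect `K`, ambient datum `A`, and every
STANDARD `E` on `A.Z` at whose closed singular points provenance edge data exist (`CampaignW31.EdgeDataExist`, the
printed «we … can choose» of Rem. 4.10), `ξ ↦ inv E ξ` is upper semicontinuous on `Sing(E)_cl` — literally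
`S16Proof.U86_2 E.sing (inv E)` in shape. Same content as `CampaignW31UscInvOneExponent` once `Inv` is well defined
(`CampaignW31InvWellDefined`); typed so that consumers written over the `inv` slot (`S06BaseHike.Eq43`,
`S16Proof.U87_2`, …) can cite the campaign statement without a translation lemma. Replaces the role of the same
printed uses (p.30 l.4–8, p.86 l.7–10); NOT a statement of the manuscript. [folklore] -/
def CampaignW31UscInvOneExponentR
    (IsEdgeData : ∀ ⦃X : Scheme.{u}⦄ ⦃p n : ℕ⦄ (E : IdealExponent X) (ξ : X), EdgeDatumAt p n E ξ → Prop) :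
    Prop :=
  ∀ (p : ℕ) [Fact p.Prime] (n : ℕ) (inv : ∀ ⦃W : Scheme.{u}⦄, IdealExponent W → W → EdgeInv n),
    IsInvReading p n IsEdgeData inv →
    ∀ (K : Type u) [Field K] [CharP K p] [PerfectField K] (A : AmbientDatum p K) (E : IdealExponent A.Z),
      E.IsStandard → EdgeDataExist p n E IsEdgeData → UscOn E.sing (inv E)

/-- **[OURS · L1 W3.1] `CampaignW31InvmaxClosed`** — the two CONSEQUENCES the manuscript needs at p.30 l.4–8
(DOSSIER §2 R13b), as one campaign statement: under the same binders, `Inv_max(E)` is attained on `Sing(E)_cl`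
whenever `Sing(E)_cl ≠ ∅` (`CampaignW31.InvmaxAttained`) and the `Inv_max`-stratum is the trace of a closed subset of
`Z` (`CampaignW31.InvmaxStratumClosed`). Replaces the role of the presupposition of §6.2 p.30 l.4–8 («the
lexicographical maximum … Sing(Ě)_cl = {ξ ∈ Sing(Ê)_cl | Inv_ξ(Ê) = Inv_max(Ê)}»); NOT a statement of the manuscript.
Expected to follow from `CampaignW31UscInvOneExponentCJS` + finiteness of the value set on the Noetherian `Z`
(tree lemma pattern CJS 2.34 (b)/(c)). [folklore] -/
def CampaignW31InvmaxClosed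
    (IsEdgeData : ∀ ⦃X : Scheme.{u}⦄ ⦃p n : ℕ⦄ (E : IdealExponent X) (ξ : X), EdgeDatumAt p n E ξ → Prop) :
    Prop :=
  ∀ (p : ℕ) [Fact p.Prime] (K : Type u) [Field K] [CharP K p] [PerfectField K] (A : AmbientDatum p K) (n : ℕ)
    (E : IdealExponent A.Z), E.IsStandard →
      ∀ sel : EdgeDataSelection p n E IsEdgeData, InvmaxAttained sel ∧ InvmaxStratumClosed sel

/-! ## Rev. 2 (2026-08-26, ADDITIVE — every declaration above is byte-identical to rev. 1, p461513; one `import` added): row 005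
part b's Def. 4.9 provenance predicate has LANDED (`S04CharAlgebra.IsEdgeData`, R005bEdgeData.lean p460257, re-filed after the review
of p457701); the parametric statements above are INSTANTIATED with it (parameter-free targets for provers): plumbing
`CampaignW31.edgeDataProvenance`; per-`p` slices `CampaignW31InvWellDefinedI`, `CampaignW31UscInvOneExponentI` (the slot
statement), `CampaignW31UscInvHypersurfaceI`, `CampaignW31UscInvOneExponentCJSI`, `CampaignW31InvmaxClosedI`; anchors
`campaignW31UscInvOneExponentI_iff` (`Iff.rfl`: parametric statement ↔ ∀ primes, slice; the other slices unfold the same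
way) and `campaignW31UscInvHypersurfaceI_of_oneExponentI`. VACUITY (rev. 2): the `…I` slices are non-vacuous exactly when
`S04CharAlgebra.IsEdgeData` is inhabited at the closed singular points (review of p457701 → p460257: generators of the
POSITIVE-degree part `edgeGPos`; existence = the typed candidate `S04CharAlgebra.Rem4_10_exists`, not asserted). The module
docstring above is rev. 1's, unchanged. -/

namespace CampaignW31

/-- [OURS · L1 W3.1] plumbing (replaces nothing printed): the Def. 4.9 provenance predicate in the parameter shape used above (and
by `S04CharAlgebra.Thm4_19`), INSTANTIATED with row 005 part b's `S04CharAlgebra.IsEdgeData` (p.20 l.31–35: homogeneous lifts of a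
minimum system of homogeneous generators `ḡ_j`, `deg ḡ_j = q_j`, of the ideal of `℘̄(E)(ξ)` in `K[z̄]`, minimum w.r.t. `z̄`). [folklore] -/
def edgeDataProvenance : ∀ ⦃X : Scheme.{u}⦄ ⦃p n : ℕ⦄ (E : IdealExponent X) (ξ : X), EdgeDatumAt p n E ξ → Prop :=
  fun _ _ _ _ _ D => S04CharAlgebra.IsEdgeData D

end CampaignW31

/-- **[OURS · L1 W3.1] `CampaignW31InvWellDefinedI p`** — `p`-slice of `CampaignW31InvWellDefined` INSTANTIATED with row 005
part b's provenance (`CampaignW31.edgeDataProvenance`): over perfect fields of characteristic `p`, any two Def. 4.9 edge data AS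
TYPED (`S04CharAlgebra.IsEdgeData`) at a closed point of `Sing(E)` give the same `Inv_ξ(E)`. Replaces the role of the implicit
well-definedness of Eq. (34) p.24 l.29–31; NOT a statement of the manuscript. (Per-`p` slices as every OURS `Prop` here, e.g.
`Theorems.PerfectRes p`; `campaignW31UscInvOneExponentI_iff` records the pattern: parametric statement ↔ ∀ primes, slice.)
[folklore] -/
def CampaignW31InvWellDefinedI (p : ℕ) [Fact p.Prime] : Prop :=
  ∀ (K : Type u) [Field K] [CharP K p] [PerfectField K] (A : AmbientDatum p K) (n : ℕ)
    (E : IdealExponent A.Z), E.IsStandard →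
      ∀ ξ ∈ E.sing ∩ S02Preliminaries.closedPoints A.Z, InvWellDefinedAt p n E CampaignW31.edgeDataProvenance ξ

/-- **[OURS · L1 W3.1] `CampaignW31UscInvOneExponentI p` — THE SLOT STATEMENT, parameter-free, `p`-slice**: the statement
`CampaignW31UscInvOneExponent` INSTANTIATED with row 005 part b's Def. 4.9 provenance (`CampaignW31.edgeDataProvenance`): for every
perfect `K` of characteristic `p`, ambient datum `A`, `n`, STANDARD `E` on `A.Z` and every selection of Def. 4.9 edge data on
`Sing(E)_cl`, `ξ ↦ Inv_ξ(E)` is upper semicontinuous on `Sing(E)_cl`. Replaces the role of p.30 l.4–8 / p.86 l.7–10 for ONE ideal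
exponent; NOT a statement of the manuscript. [folklore] -/
def CampaignW31UscInvOneExponentI (p : ℕ) [Fact p.Prime] : Prop :=
  ∀ (K : Type u) [Field K] [CharP K p] [PerfectField K] (A : AmbientDatum p K) (n : ℕ)
    (E : IdealExponent A.Z), E.IsStandard →
      ∀ sel : EdgeDataSelection p n E CampaignW31.edgeDataProvenance, UscOn E.sing (selInv sel)

/-- **[OURS · L1 W3.1] `CampaignW31UscInvHypersurfaceI p`** — the hypersurface rung (`J` effective Cartier), `p`-slice, provenance
:= `CampaignW31.edgeDataProvenance`; replaces the role of p.30 l.4–8 / p.86 l.7–10 in the hypersurface case; NOT a statement of the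
manuscript. [folklore] -/
def CampaignW31UscInvHypersurfaceI (p : ℕ) [Fact p.Prime] : Prop :=
  ∀ (K : Type u) [Field K] [CharP K p] [PerfectField K] (A : AmbientDatum p K) (n : ℕ)
    (E : IdealExponent A.Z), IsHypersurfaceExponent E →
      ∀ sel : EdgeDataSelection p n E CampaignW31.edgeDataProvenance, UscOn E.sing (selInv sel)

/-- **[OURS · L1 W3.1] `CampaignW31UscInvOneExponentCJSI p`** — the superlevel-set form, `p`-slice, provenance :=
`CampaignW31.edgeDataProvenance`; replaces the role of the same printed uses; NOT a statement of the manuscript. [folklore] -/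
def CampaignW31UscInvOneExponentCJSI (p : ℕ) [Fact p.Prime] : Prop :=
  ∀ (K : Type u) [Field K] [CharP K p] [PerfectField K] (A : AmbientDatum p K) (n : ℕ)
    (E : IdealExponent A.Z), E.IsStandard →
      ∀ sel : EdgeDataSelection p n E CampaignW31.edgeDataProvenance, SuperlevelClosedOn E.sing (selInv sel)

/-- **[OURS · L1 W3.1] `CampaignW31InvmaxClosedI p`** — `Inv_max` attained and the `Inv_max`-stratum closed in `Sing(E)_cl`,
`p`-slice, provenance := `CampaignW31.edgeDataProvenance`. Replaces the role of the presupposition of §6.2 p.30 l.4–8; NOT a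
statement of the manuscript. [folklore] -/
def CampaignW31InvmaxClosedI (p : ℕ) [Fact p.Prime] : Prop :=
  ∀ (K : Type u) [Field K] [CharP K p] [PerfectField K] (A : AmbientDatum p K) (n : ℕ)
    (E : IdealExponent A.Z), E.IsStandard →
      ∀ sel : EdgeDataSelection p n E CampaignW31.edgeDataProvenance, InvmaxAttained sel ∧ InvmaxStratumClosed sel

/-- Pure logic: the parametric slot statement at row 005 part b's provenance predicate is the conjunction over primes of the
parameter-free `p`-slices. [folklore] -/
theorem campaignW31UscInvOneExponentI_iff :
    CampaignW31UscInvOneExponent.{u} CampaignW31.edgeDataProvenance ↔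
      ∀ (p : ℕ) [Fact p.Prime], CampaignW31UscInvOneExponentI.{u} p :=
  Iff.rfl

/-- Pure logic: the `p`-slice of the general statement implies the `p`-slice of the hypersurface rung. [folklore] -/
theorem campaignW31UscInvHypersurfaceI_of_oneExponentI (p : ℕ) [Fact p.Prime] (h : CampaignW31UscInvOneExponentI.{u} p) :
    CampaignW31UscInvHypersurfaceI.{u} p :=
  fun K _ _ _ A n E hE sel => h K A n E hE.1 sel

end Summit.ResolutionOfSingularities.ResolutionOfSingularities.Theorems

end
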